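import Summits.NavierStokesRegularity.NavierStokesRegularity.Theses.AxisymmetricExtremality
import Summits.NavierStokesRegularity.NavierStokesRegularity.Theorems.AxisymmetricExtremalityAxisymmetricKatoGlobalStubSeregin2020TypeIINoSwirlRegularRepr
import HarnessLib

/-!
# Seregin 2022, §2 Step 1: the smooth axisymmetric representative on the clean slab below a first
# singular point, and uniform derivative bounds up to the top time at backward regular points —
# crux stmt-NavierStokesRegularity-15453 (`AxisymmetricExtremality.AxisymmetricKatoGlobal`), line registered, support for stub `stub_sereginLogSwirlOrigin`

Support file (`--supports stmt-NavierStokesRegularity-15453`; theorems only, everything proved)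
toward the registered stub `stub_sereginLogSwirlOrigin` = the named fact
`Literature.Analysis.FluidPDE.seregin2022_logSwirl_regularAtOrigin` (G. Seregin, J. Math. Fluid
Mech. 24 (2022), Paper 27 = arXiv:2201.00153, §2). Step 1 of the printed proof (arXiv p. 5)
uses: "According to the properties of regular points, there are cylinders `Q₁ = Q(z₁, δ)`,
`Q₂ = Q(z₂, δ)` … such that `v ∈ C([-δ², 0]; C³(𝒞̄((0, hᵢ), δ)))` at least", and Steps 2–3
(pp. 5–7) repeatedly use that "in the set `supp |∇η|`, functions `v`, `∇v`, and `∇²v` are bounded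
in space-time" / "our solution `v` has bounded spatial derivatives of any order in the support of
`∇η`". In the first-singular-time form of the argument (siblings `…FirstSingular`,
`…FinalReduction`: the reduction of the fact to the core on the configuration (C1)–(C2) around an
axis point `ẑ = (t̂, x̂)` at scale `R`) these two regularity inputs read:

* `exists_isSmoothAxisymmetricSolutionOn_cleanSlab` — (C1) (every point of the closed
  coordinate cylinder `{|x'| ≤ R, |x₃ - x̂₃| ≤ R}` at the times `t̂ - R² ≤ t < t̂` is a regular
  point) makes the open slab `Q(ẑ, R) = 𝒞(x̂, R) × ]t̂ - R², t̂[` an open, rotation invariant set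
  of regular points inside `Q`, so `v` has there a representative `V` with `(V, q)` a
  "sufficiently smooth axially symmetric solution" in the sense of Seregin–Zajaczkowski 2007
  (`exists_isSmoothAxisymmetricSolutionOn_of_regular`: suitable, axisymmetric at every point,
  slices `C^∞`, all spatial derivatives locally Hölder in space–time);
* `exists_iteratedFDeriv_bound_of_backwardRegular` — at a BACKWARD regular point `z`
  (`v ∈ L_∞(Q(z, r))`, e.g. the top-time points of (C2)) lying over an open set `O ⊆ Q` on which
  `v` has a continuous representative `V`, all spatial derivatives of `V` are bounded on a
  backward cylinder `Q(z, ρ) ⊆ O`, uniformly up to the top time `t_z` (the higher regularity of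
  bounded solutions, `NSBoundedHigherRegularity_holds`, gives a representative with Hölder
  derivatives on `Q̄(z, ρ)`; two continuous representatives agree on the open overlap);
* `exists_cleanSlab_repr` (registered sub-goal) — both combined for the configuration of
  `exists_firstSingular_configuration`: the representative `V` on `Q(ẑ, R)` and, at every point
  `a ∈ 𝒞(x̂, R)` with `(t̂, a)` backward regular, bounds `‖D_xⁿV‖ ≤ Cₙ` on some `Q((t̂, a), ρ)`.

## References

* G. Seregin, J. Math. Fluid Mech. 24 (2022), Paper No. 27 = arXiv:2201.00153, §2 Step 1 (arXiv
  p. 5), Step 2 (proof of Lemma 2.1, p. 6), Step 3 (p. 7). [`Seregin2022LocalAxisym`]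
* G. Seregin, W. Zajaczkowski, SIAM J. Math. Anal. 39 (2007) 669–685, §3. [`SereginZajaczkowski2007`]
* G. Seregin, V. Šverák, Comm. PDE 34 (2009) = arXiv:0804.1803, §2 p. 8 (higher regularity of
  bounded solutions). [`SereginSverak2009`]
-/

-- the problem directory repeats the summit name (D-0017); core's `dupNamespace` linter fires
set_option linter.dupNamespace false

noncomputable section

open MeasureTheory Set Function Filter Topology TopologicalSpace Metric
open scoped NNReal ENNReal

namespace Summit.NavierStokesRegularity.NavierStokesRegularity.Theorems.AxisymmetricKatoGlobal.EulerScaling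

open Literature.Analysis.FluidPDE Literature.Analysis.FluidPDE.SereginZajaczkowski2007
  Literature.Analysis.FluidPDE.SereginSverak2009

/-! ### Coordinate cylinders around axis points -/

/-- Around an axis point `c` the distance to the axis through `c` is the distance to the axis:
`|(x - c)'| = |x'|`. [folklore] -/
theorem cylRadius_sub_of_cylRadius_eq_zero {c : EuclideanSpace ℝ (Fin 3)} (hc : cylRadius c = 0)
    (x : EuclideanSpace ℝ (Fin 3)) : cylRadius (x - c) = cylRadius x := by
  obtain ⟨hc0, hc1⟩ := (cylRadius_eq_zero_iff c).1 hc
  simp [cylRadius, hc0, hc1]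

/-- **The slab `Q(ẑ, R)` of the configuration lies in `Q = 𝒞 × ]-1, 0[`** for an axis point
`ẑ = (t̂, x̂)` with `-1/16 < t̂ ≤ 0`, `|x̂₃| ≤ 1/4` and `0 < R ≤ 1/4`. [folklore] -/
theorem parCyl_subset_unitParCyl_of_config {zc : ℝ × EuclideanSpace ℝ (Fin 3)} {R : ℝ}
    (ht : zc.1 ∈ Ioc (-1 / 16 : ℝ) 0) (hc : cylRadius zc.2 = 0) (hx : |zc.2 2| ≤ 1 / 4)
    (hR : 0 < R) (hR4 : R ≤ 1 / 4) :
    parCyl zc R ⊆ parCyl (0 : ℝ × EuclideanSpace ℝ (Fin 3)) 1 := by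
  intro z hz
  rw [mem_parCyl, cylRadius_sub_of_cylRadius_eq_zero hc] at hz
  obtain ⟨⟨h1, h2⟩, h3, h4⟩ := hz
  rw [mem_parCyl_zero]
  have hR2 : R ^ 2 ≤ 1 / 16 := by nlinarith
  refine ⟨⟨by linarith [ht.1], by linarith [ht.2]⟩, by linarith, ?_⟩
  have h5 : |z.2 2| ≤ |z.2 2 - zc.2 2| + |zc.2 2| := by
    simpa using abs_add_le (z.2 2 - zc.2 2) (zc.2 2)
  linarith

/-! ### The smooth axisymmetric representative on the clean slab -/

/-- **Seregin 2022, §2 Step 1: on the clean slab the solution is a "sufficiently smooth axially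
symmetric solution".** Let `(v, q)` be a suitable weak solution in `Q = 𝒞 × ]-1, 0[` with
axisymmetric slices, `ẑ = (t̂, x̂)` an axis point with `-1/16 < t̂ ≤ 0`, `|x̂₃| ≤ 1/4`,
`0 < R ≤ 1/4`, and assume the clean past (C1): every `(t, x)` with `t̂ - R² ≤ t < t̂`,
`|x'| ≤ R`, `|x₃ - x̂₃| ≤ R` is a regular point of `v`. Then on the open slab
`Q(ẑ, R) = 𝒞(x̂, R) × ]t̂ - R², t̂[` — open, inside `Q`, invariant under the rotations about the
axis, made of regular points — `v` has a representative `V` (`v = V` a.e. on `Q(ẑ, R)`) with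
`(V, q)` in the Seregin–Zajaczkowski class `IsSmoothAxisymmetricSolutionOn (Q(ẑ, R)) V q`
(`exists_isSmoothAxisymmetricSolutionOn_of_regular`).
[cite: Seregin2022LocalAxisym, §2 Step 1 (arXiv:2201.00153 p. 5)] -/
theorem exists_isSmoothAxisymmetricSolutionOn_cleanSlab
    {v : ℝ → EuclideanSpace ℝ (Fin 3) → EuclideanSpace ℝ (Fin 3)}
    {q : ℝ → EuclideanSpace ℝ (Fin 3) → ℝ}
    (hsw : IsSuitableWeakSolutionOn (parCylOpens 0 1) 1 0 v q)
    (hv_ax : ∀ t ∈ Ioo (-1 : ℝ) 0, IsAxisymmetric (v t))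
    {zc : ℝ × EuclideanSpace ℝ (Fin 3)} {R : ℝ}
    (ht : zc.1 ∈ Ioc (-1 / 16 : ℝ) 0) (hc : cylRadius zc.2 = 0) (hx : |zc.2 2| ≤ 1 / 4)
    (hR : 0 < R) (hR4 : R ≤ 1 / 4)
    (hC1 : ∀ z : ℝ × EuclideanSpace ℝ (Fin 3), zc.1 - R ^ 2 ≤ z.1 → z.1 < zc.1 →
      cylRadius z.2 ≤ R → |z.2 2 - zc.2 2| ≤ R → IsRegularPoint v z) :
    ∃ V : ℝ → EuclideanSpace ℝ (Fin 3) → EuclideanSpace ℝ (Fin 3),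
      IsSmoothAxisymmetricSolutionOn (parCylOpens zc R) V q ∧
        uncurry v =ᵐ[volume.restrict (parCyl zc R)] uncurry V := by
  have hsub := parCyl_subset_unitParCyl_of_config ht hc hx hR hR4
  have hSQ : parCylOpens zc R ≤ parCylOpens (0 : ℝ × EuclideanSpace ℝ (Fin 3)) 1 :=
    fun z hz => hsub hz
  -- slices are axisymmetric at the times of `Q`
  have hax : ∀ z ∈ ((parCylOpens 0 1 : Opens (ℝ × EuclideanSpace ℝ (Fin 3))) :
      Set (ℝ × EuclideanSpace ℝ (Fin 3))), IsAxisymmetric (v z.1) := by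
    intro z hz
    rw [coe_parCylOpens, mem_parCyl_zero] at hz
    refine hv_ax z.1 ⟨?_, hz.1.2⟩
    have := hz.1.1
    norm_num at this
    exact this
  -- the slab consists of regular points
  have hSreg : ∀ z ∈ ((parCylOpens zc R : Opens (ℝ × EuclideanSpace ℝ (Fin 3))) :
      Set (ℝ × EuclideanSpace ℝ (Fin 3))), IsRegularPoint v z := by
    intro z hz
    rw [coe_parCylOpens, mem_parCyl, cylRadius_sub_of_cylRadius_eq_zero hc] at hz
    exact hC1 z hz.1.1.le hz.1.2 hz.2.1.le hz.2.2.le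
  -- the slab is rotation invariant
  have hSrot : ∀ θ : ℝ, ∀ z ∈ ((parCylOpens zc R : Opens (ℝ × EuclideanSpace ℝ (Fin 3))) :
      Set (ℝ × EuclideanSpace ℝ (Fin 3))),
      ((z.1, rotZ θ z.2) : ℝ × EuclideanSpace ℝ (Fin 3)) ∈
        ((parCylOpens zc R : Opens (ℝ × EuclideanSpace ℝ (Fin 3))) :
          Set (ℝ × EuclideanSpace ℝ (Fin 3))) := by
    intro θ z hz
    rw [coe_parCylOpens, mem_parCyl, cylRadius_sub_of_cylRadius_eq_zero hc] at hz ⊢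
    rw [cylRadius_rotZ, rotZ_apply_two]
    exact hz
  exact exists_isSmoothAxisymmetricSolutionOn_of_regular hsw hax hSQ hSreg hSrot

/-! ### Uniform derivative bounds up to the top time at backward regular points -/

/-- **Bounded spatial derivatives of every order up to the top time at a backward regular
point** ("according to the properties of regular points, there are cylinders `Q(zᵢ, δ)` … such
that `v ∈ C([-δ², 0]; C³)` at least"; "`v`, `∇v`, and `∇²v` are bounded in space-time" on
`supp |∇η|`). Let `(v, q)` be a suitable weak solution in `Q = 𝒞 × ]-1, 0[` with
`q ∈ L_{3/2}(Q)`, `O ⊆ Q` open, `V` a continuous representative of `v` on `O`, and `z` a point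
with `Q(z, r₀) ⊆ O` at which `v` is backward regular (`v ∈ L_∞(Q(z, r))` for some `r > 0`; the
top time `t_z = 0` is allowed). Then for some `ρ > 0` with `Q(z, ρ) ⊆ O`, every spatial
derivative `D_xⁿV` is bounded on `Q(z, ρ)`: the higher regularity of bounded solutions
(`NSBoundedHigherRegularity_holds`) yields a representative with Hölder continuous derivatives
on `Q̄(z, ρ)`, which agrees with `V` on the open cylinder (both continuous, equal a.e.).
[cite: Seregin2022LocalAxisym, §2 Step 1 (arXiv:2201.00153 p. 5)] -/
theorem exists_iteratedFDeriv_bound_of_backwardRegular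
    {v V : ℝ → EuclideanSpace ℝ (Fin 3) → EuclideanSpace ℝ (Fin 3)}
    {q : ℝ → EuclideanSpace ℝ (Fin 3) → ℝ}
    (hsw : IsSuitableWeakSolutionOn (parCylOpens 0 1) 1 0 v q)
    (hq : ∫⁻ z in parCyl (0 : ℝ × EuclideanSpace ℝ (Fin 3)) 1, ‖q z.1 z.2‖ₑ ^ (3 / 2 : ℝ) < ∞)
    {O : Set (ℝ × EuclideanSpace ℝ (Fin 3))}
    (hOQ : O ⊆ parCyl (0 : ℝ × EuclideanSpace ℝ (Fin 3)) 1)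
    (hVc : ContinuousOn (uncurry V) O) (hae : uncurry v =ᵐ[volume.restrict O] uncurry V)
    {z : ℝ × EuclideanSpace ℝ (Fin 3)} {r₀ : ℝ} (hr₀ : 0 < r₀) (hzO : parabolicCylinder r₀ z ⊆ O)
    (hreg : ∃ r > 0, eLpNorm (uncurry v) ∞ (volume.restrict (parabolicCylinder r z)) < ∞) :
    ∃ ρ > 0, parabolicCylinder ρ z ⊆ O ∧ ∀ n : ℕ, ∃ C : ℝ,
      ∀ w ∈ parabolicCylinder ρ z, ‖iteratedFDeriv ℝ n (V w.1) w.2‖ ≤ C := by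
  obtain ⟨r₁, hr₁, hfin₁⟩ := hreg
  -- a backward cylinder `Q(z, r) ⊆ O` on which `v` is essentially bounded
  set r : ℝ := min r₀ r₁ with hr_def
  have hr : 0 < r := lt_min hr₀ hr₁
  have hrO : parabolicCylinder r z ⊆ O :=
    (parabolicCylinder_mono hr.le (min_le_left _ _) z).trans hzO
  have hfin : eLpNorm (uncurry v) ∞ (volume.restrict (parabolicCylinder r z)) < ∞ :=
    (eLpNorm_mono_measure _ (Measure.restrict_mono
      (parabolicCylinder_mono hr.le (min_le_right _ _) z) le_rfl)).trans_lt hfin₁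
  -- the hypotheses of the higher-regularity theorem on `Q(z, r)`
  have hle : parabolicCylinderOpens r z ≤ parCylOpens (0 : ℝ × EuclideanSpace ℝ (Fin 3)) 1 :=
    fun w hw => hOQ (hrO hw)
  have hdist : IsDistributionalNSSolutionOn (parabolicCylinderOpens r z) 1 0 v q :=
    hsw.distributional.of_le hle
  have hbd : ∀ᵐ w ∂(volume.restrict (parabolicCylinder r z)),
      ‖v w.1 w.2‖ ≤ (eLpNorm (uncurry v) ∞ (volume.restrict (parabolicCylinder r z))).toReal := by
    -- adapted from `exists_nhds_ae_norm_le_of_isRegularPoint`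
    filter_upwards [ae_le_eLpNormEssSup (f := uncurry v)
      (μ := volume.restrict (parabolicCylinder r z))] with w hw
    rw [← eLpNorm_exponent_top] at hw
    calc ‖v w.1 w.2‖ = ‖uncurry v w‖ₑ.toReal := (toReal_enorm _).symm
      _ ≤ (eLpNorm (uncurry v) ∞ (volume.restrict (parabolicCylinder r z))).toReal :=
        ENNReal.toReal_mono hfin.ne hw
  have hp : ∫⁻ w in parabolicCylinder r z, ‖q w.1 w.2‖ₑ ^ (3 / 2 : ℝ) < ∞ :=
    (lintegral_mono_set (hrO.trans hOQ)).trans_lt hq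
  obtain ⟨W, haeW, -, hHol⟩ := NSBoundedHigherRegularity_holds v q z r _ hdist hbd hp
  -- the two representatives agree on `Q(z, r/2)`
  have hρr : r / 2 ∈ Ioo 0 r := ⟨by positivity, by linarith⟩
  have hsub2 : parabolicCylinder (r / 2) z ⊆ parabolicCylinder r z :=
    parabolicCylinder_mono (by positivity) (by linarith) z
  obtain ⟨C₀, α₀, hα₀, hH₀⟩ := hHol 0 (r / 2) hρr
  have hWc : ContinuousOn (uncurry W) (parabolicCylinder (r / 2) z) :=
    continuousOn_uncurry_of_holderOnWith_zero hα₀ hH₀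
  have h1 : uncurry v =ᵐ[volume.restrict (parabolicCylinder (r / 2) z)] uncurry V :=
    ae_restrict_of_ae_restrict_of_subset (hsub2.trans hrO) hae
  have h2 : uncurry v =ᵐ[volume.restrict (parabolicCylinder (r / 2) z)] uncurry W :=
    ae_restrict_of_ae_restrict_of_subset hsub2 haeW
  have hVW : uncurry V =ᵐ[volume.restrict (parabolicCylinder (r / 2) z)] uncurry W :=
    h1.symm.trans h2
  have hEq : EqOn (uncurry V) (uncurry W) (parabolicCylinder (r / 2) z) :=
    Measure.eqOn_open_of_ae_eq hVW (isOpen_parabolicCylinder _ _)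
      (hVc.mono (hsub2.trans hrO)) hWc
  -- bounds for `W` from the Hölder estimate, transferred to `V`
  refine ⟨r / 2, by positivity, hsub2.trans hrO, fun n => ?_⟩
  obtain ⟨C, α, -, hH⟩ := hHol n (r / 2) hρr
  set w₀ : ℝ × EuclideanSpace ℝ (Fin 3) := (z.1 - (r / 2) ^ 2 / 2, z.2) with hw₀
  have hw₀mem : w₀ ∈ parabolicCylinder (r / 2) z := by
    rw [mem_parabolicCylinder, hw₀, dist_self]
    refine ⟨⟨?_, ?_⟩, by positivity⟩ <;> simp only <;> nlinarith [pow_pos hr 2]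
  set D : ℝ := (r / 2) ^ 2 + r / 2 with hD
  refine ⟨‖iteratedFDeriv ℝ n (W w₀.1) w₀.2‖ + C * D ^ (α : ℝ), fun w hw => ?_⟩
  have hdist : dist w w₀ ≤ D := by
    rw [Prod.dist_eq, max_le_iff, Real.dist_eq]
    rw [mem_parabolicCylinder] at hw
    have h1 : w₀.1 = z.1 - (r / 2) ^ 2 / 2 := rfl
    have h2 : w₀.2 = z.2 := rfl
    rw [h1, h2]
    refine ⟨?_, by nlinarith [hw.2, sq_nonneg (r / 2)]⟩
    rw [abs_le]
    constructor <;> nlinarith [hw.1.1, hw.1.2]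
  have hH' := hH.dist_le_of_le hw hw₀mem hdist
  rw [dist_eq_norm] at hH'
  rw [iteratedFDeriv_slice_eq_of_eqOn (isOpen_parabolicCylinder _ _) hEq n hw]
  calc ‖iteratedFDeriv ℝ n (W w.1) w.2‖
      = ‖(iteratedFDeriv ℝ n (W w.1) w.2 - iteratedFDeriv ℝ n (W w₀.1) w₀.2) +
          iteratedFDeriv ℝ n (W w₀.1) w₀.2‖ := by rw [sub_add_cancel]
    _ ≤ ‖iteratedFDeriv ℝ n (W w.1) w.2 - iteratedFDeriv ℝ n (W w₀.1) w₀.2‖ +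
          ‖iteratedFDeriv ℝ n (W w₀.1) w₀.2‖ := norm_add_le _ _
    _ ≤ C * D ^ (α : ℝ) + ‖iteratedFDeriv ℝ n (W w₀.1) w₀.2‖ := by gcongr
    _ = ‖iteratedFDeriv ℝ n (W w₀.1) w₀.2‖ + C * D ^ (α : ℝ) := add_comm _ _

/-! ### The registered sub-goal: representative and top-time bounds on the configuration -/

/-- **Seregin 2022, §2 Step 1, the regularity inputs of Steps 2–4 on the clean configuration.**
For `(v, q)` in the Def.-1.1 class in `Q = 𝒞 × ]-1, 0[` (suitable weak solution, `q ∈ L_{3/2}(Q)`)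
with axisymmetric slices, an axis point `ẑ = (t̂, x̂)` (`-1/16 < t̂ ≤ 0`, `|x̂₃| ≤ 1/4`), a scale
`0 < R ≤ 1/4` and the clean past (C1), there is a representative `V` of `v` on the slab
`Q(ẑ, R)` with `(V, q)` a sufficiently smooth axially symmetric solution there
(Seregin–Zajaczkowski class), such that at every `a ∈ 𝒞(x̂, R)` with `(t̂, a)` backward regular
(the top-slice points of (C2): off the axis, or in the strips around the regular heights `h±`)
all spatial derivatives of `V` are bounded on a backward cylinder `Q((t̂, a), ρ) ⊆ Q(ẑ, R)`, up
to the top time: "`v`, `∇v`, `∇²v` [indeed derivatives of any order] are bounded in space-time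
in `supp |∇η|`". [cite: Seregin2022LocalAxisym, §2 Step 1 (arXiv:2201.00153 p. 5)] -/
theorem exists_cleanSlab_repr : ∀ (v : ℝ → EuclideanSpace ℝ (Fin 3) → EuclideanSpace ℝ (Fin 3)) (q : ℝ → EuclideanSpace ℝ (Fin 3) → ℝ), IsSuitableWeakSolutionOn (SereginSverak2009.parCylOpens 0 1) 1 0 v q → (∫⁻ z in SereginSverak2009.parCyl 0 1, ‖q z.1 z.2‖ₑ ^ (3 / 2 : ℝ) < ∞) → (∀ t ∈ Ioo (-1 : ℝ) 0, IsAxisymmetric (v t)) → ∀ (zc : ℝ × EuclideanSpace ℝ (Fin 3)) (R : ℝ), zc.1 ∈ Ioc (-1 / 16 : ℝ) 0 → cylRadius zc.2 = 0 → |zc.2 2| ≤ 1 / 4 → 0 < R → R ≤ 1 / 4 → (∀ z : ℝ × EuclideanSpace ℝ (Fin 3), zc.1 - R ^ 2 ≤ z.1 → z.1 < zc.1 → cylRadius z.2 ≤ R → |z.2 2 - zc.2 2| ≤ R → IsRegularPoint v z) → ∃ V : ℝ → EuclideanSpace ℝ (Fin 3) → EuclideanSpace ℝ (Fin 3), SereginZajaczkowski2007.IsSmoothAxisymmetricSolutionOn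 (SereginSverak2009.parCylOpens zc R) V q ∧ uncurry v =ᵐ[volume.restrict (SereginSverak2009.parCyl zc R)] uncurry V ∧ ∀ a ∈ SereginSverak2009.spaceCyl zc.2 R, (∃ r > 0, eLpNorm (uncurry v) ∞ (volume.restrict (parabolicCylinder r ((zc.1, a) : ℝ × EuclideanSpace ℝ (Fin 3)))) < ∞) → ∃ ρ > 0, parabolicCylinder ρ ((zc.1, a) : ℝ × EuclideanSpace ℝ (Fin 3)) ⊆ SereginSverak2009.parCyl zc R ∧ ∀ n : ℕ, ∃ C : ℝ, ∀ w ∈ parabolicCylinder ρ ((zc.1, a) : ℝ × EuclideanSpace ℝ (Fin 3)), ‖iteratedFDeriv ℝ n (V w.1) w.2‖ ≤ C := by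
  intro v q hsw hq hv_ax zc R ht hc hx hR hR4 hC1
  obtain ⟨V, hV, hae⟩ := exists_isSmoothAxisymmetricSolutionOn_cleanSlab hsw hv_ax ht hc hx hR hR4 hC1
  refine ⟨V, hV, hae, fun a ha hreg => ?_⟩
  -- a backward cylinder at `(t̂, a)` inside the slab
  obtain ⟨ε, hε, hεsub⟩ := Metric.isOpen_iff.1 (isOpen_spaceCyl zc.2 R) a ha
  set r₀ : ℝ := min ε R with hr₀
  have hr₀pos : 0 < r₀ := lt_min hε hR
  have hzO : parabolicCylinder r₀ ((zc.1, a) : ℝ × EuclideanSpace ℝ (Fin 3)) ⊆ parCyl zc R := by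
    intro w hw
    rw [mem_parabolicCylinder] at hw
    have h1 : r₀ ^ 2 ≤ R ^ 2 := pow_le_pow_left₀ hr₀pos.le (min_le_right _ _) 2
    exact ⟨⟨by simp only at hw; linarith [hw.1.1], hw.1.2⟩,
      hεsub (mem_ball.2 (hw.2.trans_le (min_le_left _ _)))⟩
  exact exists_iteratedFDeriv_bound_of_backwardRegular hsw hq
    (parCyl_subset_unitParCyl_of_config ht hc hx hR hR4) hV.continuousOn_velocity hae hr₀pos
    hzO hreg

end Summit.NavierStokesRegularity.NavierStokesRegularity.Theorems.AxisymmetricKatoGlobal.EulerScaling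

end
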